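import Summits.QuantumFields.YangMills.Theorems.UnitScaleTiltProp8HalvingDressingLetterT3
import Summits.QuantumFields.YangMills.Theorems.UnitScaleTiltProp8DressingTransposeLetters
import HarnessLib

/-!
# Route `UnitScaleTilt`, crux K1 child «MinimiserStabilityRegPr» (stmt-QuantumFields-19200), registered stub V2′ `stub_halvingStep`
# (skeletons v8 5b4e846794b80374 ∕ v10 `BirthV10`) — **THE DRESSING LETTER `C_E`: THE (X2) JUNCTION** — the M2 knit
# (`HalvingDressingLetter.hWq_dressed_of_letters`, ✓ p607120) with its composite transpose letters (X2a) ∕ (X2-T) DISCHARGED BY NAME from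
# ★w8-19936 g0's ✓ p607131 `DressingTransposeLetters.X2a_fderiv` ∕ `X2T_letter_fderiv` (consumed VERBATIM), so that the displayed supplier residue of
# `C_E` is exactly the three COLUMN letters (X2-H) `hHcol`, (X2-C′) `hCcol`, (X2-CH) `hCH` (OWNER g26 ASSIGNMENTS 10 (b)), the chart's regularity near each
# sized field ((49) `D = C∘Ψ` eventually, `D`∕`C` differentiable), and (X1) ∕ (46) ∕ (55) ∕ (98)₀

Cell `ym3-torus` (HUMAN RULING D-0037, YM ladder rung R3 — continuum SU(2) YM₃ on the torus is a RUNG, not the Clay problem), width seat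
`ym-ust-19200-w6` gen 0 (D-0154 (3c)).  `--supports stmt-QuantumFields-19200 --as helper`; def-free, 0 sorry, standard axioms.

WHAT THIS FILE PROVES (no definition, no sorry; `M₂ = Matrix (Fin 2) (Fin 2) ℂ` with the L²-operator norm; `CC Z b = η⁻²Σ_p σ(p,b)•Φ_p(Z)`;
`e_{b,ji} = Pi.single b (Matrix.single j i 1)`; sizes `w 1‖Y‖ ≤ r`, `w 2·c·‖∇Y‖ ≤ r`; currents weighted by `w 3 > 0`; ONE shared index weight `u ≥ 0`):
* ★★**`hWq_dressed_of_columnLetters`** — level-0 bonds of any `P`, level weights `w`, lattice factor `c`: for `W Y = W₀(Y − H(D Y)) + E Y` with the EXPLICIT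
  `E` of `HalvingDressedCriticality.fderiv_dressed_eq_pairing` (`hE` verbatim): (98)₀ (`C₀` below `a₀`) ∧ (46) (`B_H`) ∧ (55) (`4C₂r²` below `R`) ∧ (X1)
  (`B_Δ`) ∧ the chart's regularity below `R` (`h49 : ∀ᶠ X in 𝓝 Y, D X = C (X − H (D X))`, `DifferentiableAt ℂ D Y`, `DifferentiableAt ℂ C (ΨY)`) ∧
  **(X2-C′)** `Σ_c u c‖(fderiv ℂ C (ΨY)) δ c‖ ≤ (C₃·r)·Σ_b (w 3 b)⁻¹‖δ b‖` ∧ **(X2-H)** `Σ_b (w 3 b)⁻¹‖H X b‖ ≤ h₁·Σ_c u c‖X c‖` ∧ **(X2-CH)**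
  `‖Σ_b tr(CC(H X) b·Z b)‖ ≤ B_CH·s·Σ_c u c‖X c‖` for `size(Z) ≤ s` ∧ `C₃·R·h₁ ≤ ½` ⟹ `w 3 b·‖W Y b‖ ≤ C₄·r²` below `a₃`,
  `C₄ = C₀θ² + 2B_ΔC₂ + ½(8C₃B_CH)θ + (16h₁C₃)R₀C₀θ²`, `θ = 1 + 4B_HC₂R₀` — i.e. `hWq_dressed_of_letters` with `B₂ := 8C₃B_CH` (by `X2a_fderiv` ∘
  `curlCurl_pairing_symm`) and `B₃ := 16h₁C₃` (by `X2T_letter_fderiv`).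
* ★★**`exists_hWq_dressed_cubeSeq_T3_of_columnLetters`** — the same at the aligned cube sequence (144) of the d = 3 carrier with P3b's `W₀` BY NAME
  (✓ p600749: `a₀ = 1/(2L)`, `C₀ = 12L³(1428 + L)`; `η = L^{−(K−n)}`, `c = L^{K−n}`), in the `hWq` binder shape of ✓ p603846 `row165_of_tracePairing_L5_anyW`.
HONEST SCOPE.  NO supplier letter is proved here: (X2-H) = ★w8-19200 g0's `ChartHInv.column_letter` ∕ ★w3-19936 g4's concrete half, (X2-C′) = the (72)-supplier
(★w4-19200 g3 LOCATE; [Balaban1985Averaging] Prop. 5 (157) in the flat basis), (X2-CH) = ★w3-19936 g4, (X1) matrix∕chart bridge via (X3′), (46)∕(55) = P2∕P3a,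
(49) near the sized fields = P3a's `chart47W`; the index weight of record is `u i = (η⁻¹)³·(L^{lev i}η)⁻¹` (this file keeps `u` abstract).  NOT a claim about
the stub, the crux, the rung or the mass gap; no summit statement is proved by this seat.

References: T. Bałaban, CMP **102** (1985) 277–309 [Balaban1985Variational] (46) p.285, (49) p.285, (55) p.286, (63)–(73) pp.287–289, (80)–(89) pp.290–291,
Prop. 4 (97)–(98) pp.292–293, (144) p.300, (157)–(158) p.302.
-/

set_option autoImplicit false

noncomputable section

open scoped BigOperators Matrix Matrix.Norms.L2Operator
open NormedSpace Filter Topology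

namespace Summit.QuantumFields.YangMills.Theorems.HalvingDressingLetter

open Literature.MathematicalPhysics.QuantumFieldTheory.Balaban1983to89
open DressingTransposeLetters (X2a_fderiv X2T_letter_fderiv)

/-! ## §1 Level-0 bonds, general level weights: the composite letters discharged by the column letters -/

section Columns

variable {P : Params} {β' : Type*} [Fintype β']

/-- **THE M2 KNIT WITH THE (X2) COLUMN LETTERS DISPLAYED** (see the module docstring): `hWq_dressed_of_letters` with (X2a) := `X2a_fderiv` ∘
`curlCurl_pairing_symm` (`B₂ = 8C₃B_CH`) and (X2-T) := `X2T_letter_fderiv` (`B₃ = 16h₁C₃`), ★w8-19936 g0's shapes consumed verbatim (`c₃ := C₃·r`, `hsmall` from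
`C₃·R·h₁ ≤ ½`). [cite: Balaban1985Variational, (46) p.285, (49) p.285, (55) p.286, (73) p.289, (84)-(89) pp.290-291, Prop. 4 (97)-(98) pp.292-293, (157)-(158) p.302] -/
theorem hWq_dressed_of_columnLetters (η : ℝ) (hη : η ≠ 0) (w : ℕ → PBond P 0 → ℝ) (hw : ∀ m b, 0 ≤ w m b) (hw3 : ∀ b, 0 < w 3 b)
    (c : ℝ) (hc : 0 ≤ c) (u : β' → ℝ) (hu : ∀ c', 0 ≤ u c')
    (W W₀ E : (PBond P 0 → Matrix (Fin 2) (Fin 2) ℂ) → (PBond P 0 → Matrix (Fin 2) (Fin 2) ℂ))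
    (H : (β' → Matrix (Fin 2) (Fin 2) ℂ) →ₗ[ℂ] (PBond P 0 → Matrix (Fin 2) (Fin 2) ℂ)) (C D : (PBond P 0 → Matrix (Fin 2) (Fin 2) ℂ) → (β' → Matrix (Fin 2) (Fin 2) ℂ))
    {C₀ a₀ B_H C₂ R R₀ a₃ B_Δ C₃ h₁ B_CH : ℝ}
    (hW : ∀ Y, W Y = W₀ (Y - H (D Y)) + E Y)
    (hE : ∀ (Y : PBond P 0 → Matrix (Fin 2) (Fin 2) ℂ) (b : PBond P 0) (i j : Fin 2), E Y b i j = ((η : ℂ) ^ 4)⁻¹ *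
      (-(((η : ℂ) ^ 2 / 2) * ∑ p : Plaq P 0, Matrix.trace ((H (D Y) ⟨p.src, p.μ⟩ + H (D Y) ⟨p.src.shift p.μ, p.ν⟩ - H (D Y) ⟨p.src.shift p.ν, p.μ⟩ - H (D Y) ⟨p.src, p.ν⟩) *
          (((Pi.single b (Matrix.single j i (1 : ℂ)) : PBond P 0 → Matrix (Fin 2) (Fin 2) ℂ)) ⟨p.src, p.μ⟩ + ((Pi.single b (Matrix.single j i (1 : ℂ)) : PBond P 0 → Matrix (Fin 2) (Fin 2) ℂ)) ⟨p.src.shift p.μ, p.ν⟩ -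
            ((Pi.single b (Matrix.single j i (1 : ℂ)) : PBond P 0 → Matrix (Fin 2) (Fin 2) ℂ)) ⟨p.src.shift p.ν, p.μ⟩ - ((Pi.single b (Matrix.single j i (1 : ℂ)) : PBond P 0 → Matrix (Fin 2) (Fin 2) ℂ)) ⟨p.src, p.ν⟩)))
        - ((η : ℂ) ^ 2 / 2) * ∑ p : Plaq P 0, Matrix.trace (((Y - H (D Y)) ⟨p.src, p.μ⟩ + (Y - H (D Y)) ⟨p.src.shift p.μ, p.ν⟩ - (Y - H (D Y)) ⟨p.src.shift p.ν, p.μ⟩ - (Y - H (D Y)) ⟨p.src, p.ν⟩) *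
          (H (fderiv ℂ D Y (Pi.single b (Matrix.single j i (1 : ℂ)))) ⟨p.src, p.μ⟩ + H (fderiv ℂ D Y (Pi.single b (Matrix.single j i (1 : ℂ)))) ⟨p.src.shift p.μ, p.ν⟩ -
            H (fderiv ℂ D Y (Pi.single b (Matrix.single j i (1 : ℂ)))) ⟨p.src.shift p.ν, p.μ⟩ - H (fderiv ℂ D Y (Pi.single b (Matrix.single j i (1 : ℂ)))) ⟨p.src, p.ν⟩))
        - (η : ℂ) ^ 4 * ∑ b' : PBond P 0, Matrix.trace (W₀ (Y - H (D Y)) b' * H (fderiv ℂ D Y (Pi.single b (Matrix.single j i (1 : ℂ)))) b')))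
    (hW₀ : ∀ (Z : PBond P 0 → Matrix (Fin 2) (Fin 2) ℂ) (s : ℝ), s < a₀ → (∀ b, w 1 b * ‖Z b‖ ≤ s) →
      (∀ (b : PBond P 0) (ν : Fin P.d), w 2 b * c * ‖Z ⟨b.src.shift ν, b.dir⟩ - Z b‖ ≤ s) → ∀ b, w 3 b * ‖W₀ Z b‖ ≤ C₀ * s ^ 2)
    (hH : ∀ (X : β' → Matrix (Fin 2) (Fin 2) ℂ) (t : ℝ), (∀ c', ‖X c'‖ ≤ t) →
      (∀ b, w 1 b * ‖H X b‖ ≤ B_H * t) ∧ ∀ (b : PBond P 0) (ν : Fin P.d), w 2 b * c * ‖H X ⟨b.src.shift ν, b.dir⟩ - H X b‖ ≤ B_H * t)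
    (hD : ∀ (Y : PBond P 0 → Matrix (Fin 2) (Fin 2) ℂ) (r' : ℝ), r' < R → (∀ b, w 1 b * ‖Y b‖ ≤ r') →
      (∀ (b : PBond P 0) (ν : Fin P.d), w 2 b * c * ‖Y ⟨b.src.shift ν, b.dir⟩ - Y b‖ ≤ r') → ∀ c', ‖D Y c'‖ ≤ 4 * C₂ * r' ^ 2)
    (hX1 : ∀ (X : β' → Matrix (Fin 2) (Fin 2) ℂ) (t : ℝ), 0 ≤ t → (∀ c', ‖X c'‖ ≤ t) → ∀ b : PBond P 0,
      w 3 b * ‖(((η : ℂ) ^ 2)⁻¹ • ∑ p : Plaq P 0, ((Pi.single b (1 : ℂ) : PBond P 0 → ℂ) ⟨p.src, p.μ⟩ + (Pi.single b (1 : ℂ) : PBond P 0 → ℂ) ⟨p.src.shift p.μ, p.ν⟩ - (Pi.single b (1 : ℂ) : PBond P 0 → ℂ) ⟨p.src.shift p.ν, p.μ⟩ - (Pi.single b (1 : ℂ) : PBond P 0 → ℂ) ⟨p.src, p.ν⟩) • (H X ⟨p.src, p.μ⟩ + H X ⟨p.src.shift p.μ, p.ν⟩ - H X ⟨p.src.shift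 p.ν, p.μ⟩ - H X ⟨p.src, p.ν⟩))‖ ≤ B_Δ * t)
    (h49 : ∀ (Y : PBond P 0 → Matrix (Fin 2) (Fin 2) ℂ) (r : ℝ), r < R → (∀ b, w 1 b * ‖Y b‖ ≤ r) →
      (∀ (b : PBond P 0) (ν : Fin P.d), w 2 b * c * ‖Y ⟨b.src.shift ν, b.dir⟩ - Y b‖ ≤ r) →
      ∀ᶠ X in 𝓝 Y, D X = C (X - H (D X)))
    (hDd : ∀ (Y : PBond P 0 → Matrix (Fin 2) (Fin 2) ℂ) (r : ℝ), r < R → (∀ b, w 1 b * ‖Y b‖ ≤ r) →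
      (∀ (b : PBond P 0) (ν : Fin P.d), w 2 b * c * ‖Y ⟨b.src.shift ν, b.dir⟩ - Y b‖ ≤ r) → DifferentiableAt ℂ D Y)
    (hCd : ∀ (Y : PBond P 0 → Matrix (Fin 2) (Fin 2) ℂ) (r : ℝ), r < R → (∀ b, w 1 b * ‖Y b‖ ≤ r) →
      (∀ (b : PBond P 0) (ν : Fin P.d), w 2 b * c * ‖Y ⟨b.src.shift ν, b.dir⟩ - Y b‖ ≤ r) → DifferentiableAt ℂ C (Y - H (D Y)))
    (hCcol : ∀ (Y : PBond P 0 → Matrix (Fin 2) (Fin 2) ℂ) (r : ℝ), r < R → (∀ b, w 1 b * ‖Y b‖ ≤ r) →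
      (∀ (b : PBond P 0) (ν : Fin P.d), w 2 b * c * ‖Y ⟨b.src.shift ν, b.dir⟩ - Y b‖ ≤ r) →
      ∀ δ : PBond P 0 → Matrix (Fin 2) (Fin 2) ℂ, ∑ c', u c' * ‖fderiv ℂ C (Y - H (D Y)) δ c'‖ ≤ C₃ * r * ∑ b, (w 3 b)⁻¹ * ‖δ b‖)
    (hHcol : ∀ X : β' → Matrix (Fin 2) (Fin 2) ℂ, ∑ b, (w 3 b)⁻¹ * ‖H X b‖ ≤ h₁ * ∑ c', u c' * ‖X c'‖)
    (hCH : ∀ (Z : PBond P 0 → Matrix (Fin 2) (Fin 2) ℂ) (s : ℝ), 0 ≤ s → (∀ b, w 1 b * ‖Z b‖ ≤ s) →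
      (∀ (b : PBond P 0) (ν : Fin P.d), w 2 b * c * ‖Z ⟨b.src.shift ν, b.dir⟩ - Z b‖ ≤ s) →
      ∀ X : β' → Matrix (Fin 2) (Fin 2) ℂ, ‖∑ b, Matrix.trace ((((η : ℂ) ^ 2)⁻¹ • ∑ p : Plaq P 0, ((Pi.single b (1 : ℂ) : PBond P 0 → ℂ) ⟨p.src, p.μ⟩ + (Pi.single b (1 : ℂ) : PBond P 0 → ℂ) ⟨p.src.shift p.μ, p.ν⟩ - (Pi.single b (1 : ℂ) : PBond P 0 → ℂ) ⟨p.src.shift p.ν, p.μ⟩ - (Pi.single b (1 : ℂ) : PBond P 0 → ℂ) ⟨p.src, p.ν⟩) • (H X ⟨p.src, p.μ⟩ + H X ⟨p.src.shift p.μ, p.ν⟩ - H X ⟨p.src.shift p.ν, p.μ⟩ - H X ⟨p.src, p.ν⟩)) * Z b)‖ ≤ B_CH * s * ∑ c', u c' * ‖X c'‖)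
    (hsmall : C₃ * R * h₁ ≤ 1 / 2) (hC₃ : 0 ≤ C₃) (hh₁ : 0 ≤ h₁) (hB_CH : 0 ≤ B_CH)
    (hC₂ : 0 ≤ C₂) (hB_H : 0 ≤ B_H) (hR₀0 : 0 ≤ R₀) (hR₀ : R₀ < R) (ha₃ : a₃ ≤ R₀) (hθ : (1 + 4 * B_H * C₂ * R₀) * a₃ ≤ a₀) :
    ∀ (Y : PBond P 0 → Matrix (Fin 2) (Fin 2) ℂ) (r : ℝ), r < a₃ → (∀ b, w 1 b * ‖Y b‖ ≤ r) →
      (∀ (b : PBond P 0) (ν : Fin P.d), w 2 b * c * ‖Y ⟨b.src.shift ν, b.dir⟩ - Y b‖ ≤ r) →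
      ∀ b, w 3 b * ‖W Y b‖ ≤
        (C₀ * (1 + 4 * B_H * C₂ * R₀) ^ 2 +
          (2 * B_Δ * C₂ + 2⁻¹ * (8 * C₃ * B_CH) * (1 + 4 * B_H * C₂ * R₀) +
            (16 * h₁ * C₃) * R₀ * C₀ * (1 + 4 * B_H * C₂ * R₀) ^ 2)) * r ^ 2 := by
  have hB₃ : (0 : ℝ) ≤ 16 * h₁ * C₃ := by positivity
  refine hWq_dressed_of_letters η hη w hw c hc W W₀ E H D hW hE hW₀ hH hD hX1 ?_ ?_ hC₂ hB_H hB₃ hR₀0 hR₀ ha₃ hθ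
  · -- (X2a) from `X2a_fderiv` and the symmetry of `CC`
    intro Y r hr hY1 hY2 Z s hs hZ1 hZ2 b
    have hr0 : 0 ≤ r := (mul_nonneg (hw 1 b) (norm_nonneg _)).trans (hY1 b)
    have hc₃ : 0 ≤ C₃ * r := mul_nonneg hC₃ hr0
    have hsm : C₃ * r * h₁ ≤ 1 / 2 :=
      (mul_le_mul_of_nonneg_right (mul_le_mul_of_nonneg_left hr.le hC₃) hh₁).trans hsmall
    have h := X2a_fderiv C D H (fun (Z : PBond P 0 → Matrix (Fin 2) (Fin 2) ℂ) (b₀ : PBond P 0) => (((η : ℂ) ^ 2)⁻¹ • ∑ p : Plaq P 0, ((Pi.single b₀ (1 : ℂ) : PBond P 0 → ℂ) ⟨p.src, p.μ⟩ + (Pi.single b₀ (1 : ℂ) : PBond P 0 → ℂ) ⟨p.src.shift p.μ, p.ν⟩ - (Pi.single b₀ (1 : ℂ) : PBond P 0 → ℂ) ⟨p.src.shift p.ν, p.μ⟩ - (Pi.single b₀ (1 : ℂ) : PBond P 0 → ℂ) ⟨p.src, p.ν⟩) • (Z ⟨p.src, p.μ⟩ + Z ⟨p.src.shift p.μ, p.ν⟩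 - Z ⟨p.src.shift p.ν, p.μ⟩ - Z ⟨p.src, p.ν⟩))) (w 3) u hw3 hu hc₃
      (mul_nonneg hB_CH hs) (h49 Y r hr hY1 hY2) (hDd Y r hr hY1 hY2) (hCd Y r hr hY1 hY2) (hCcol Y r hr hY1 hY2) hHcol hsm
      (curlCurl_pairing_symm η) Z (hCH Z s hs hZ1 hZ2) b
    calc _ ≤ 8 * (C₃ * r) * B_CH * s := h
      _ = 8 * C₃ * B_CH * r * s := by ring
  · -- (X2-T) from `X2T_letter_fderiv`
    intro Y r hr hY1 hY2 J t ht hJ b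
    have hr0 : 0 ≤ r := (mul_nonneg (hw 1 b) (norm_nonneg _)).trans (hY1 b)
    have hc₃ : 0 ≤ C₃ * r := mul_nonneg hC₃ hr0
    have hsm : C₃ * r * h₁ ≤ 1 / 2 :=
      (mul_le_mul_of_nonneg_right (mul_le_mul_of_nonneg_left hr.le hC₃) hh₁).trans hsmall
    have h := X2T_letter_fderiv C D H (w 3) u hw3 hu hc₃ hh₁ (h49 Y r hr hY1 hY2) (hDd Y r hr hY1 hY2) (hCd Y r hr hY1 hY2)
      (hCcol Y r hr hY1 hY2) hHcol hsm J ht hJ b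
    calc _ ≤ 16 * h₁ * (C₃ * r) * t := h
      _ = 16 * h₁ * C₃ * r * t := by ring

end Columns

/-! ## §2 At the d = 3 cube sequence: P3b's `W₀` by name, the column letters displayed -/

section T3

open T3ContinuumYM3Torus (T3Family)
open FlatCubeOpsText (IsLevWeight)
open FlatCubeSequenceAligned (cubeSeqMT3)
open FlatProp4Bg1 (exists_gradient_weighted98_cubeSeq_T3)

/-- **THE M2 KNIT AT THE ALIGNED CUBE SEQUENCE WITH THE (X2) COLUMN LETTERS DISPLAYED** (`η = L^{−(K−n)}`, `c = L^{K−n}`, level weights `w` of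
`cubeSeqMT3 F n K x₀ ρ S M`): `exists_hWq_dressed_cubeSeq_T3` with (X2a)∕(X2-T) discharged by ★w8-19936 g0's `X2a_fderiv`∕`X2T_letter_fderiv` — P3b's `W₀` by
name (`a₀ = 1/(2L)`, `C₀ = 12L³(1428 + L)`), `E` the explicit dressing term for this `W₀`, conclusion in the `hWq` binder shape of
`HalvingA1Row165TraceAnyW.row165_of_tracePairing_L5_anyW` with `C₄ = C₀θ² + 2B_ΔC₂ + 4C₃B_CHθ + 16h₁C₃R₀C₀θ²`, `θ = 1 + 4B_HC₂R₀`, `θa₃ ≤ 1/(2L)`.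
[cite: Balaban1985Variational, (46) p.285, (49) p.285, (55) p.286, (73) p.289, (80)-(89) pp.290-291, Prop. 4 (97)-(98) pp.292-293, (144) p.300, (157)-(158) p.302] -/
theorem exists_hWq_dressed_cubeSeq_T3_of_columnLetters (F : T3Family) (n K : ℕ) (x₀ : Site (F.P K) 0) (ρ S M : ℕ) (hM : 1 ≤ M)
    (hS : 2 * F.L ≤ S) {w : ℕ → PBond (F.P K) 0 → ℝ} (hw : IsLevWeight F n K (cubeSeqMT3 F n K x₀ ρ S M hM) w)
    {β' : Type*} [Fintype β'] (u : β' → ℝ) (hu : ∀ c', 0 ≤ u c')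
    (H : (β' → Matrix (Fin 2) (Fin 2) ℂ) →ₗ[ℂ] (PBond (F.P K) 0 → Matrix (Fin 2) (Fin 2) ℂ)) (C D : (PBond (F.P K) 0 → Matrix (Fin 2) (Fin 2) ℂ) → (β' → Matrix (Fin 2) (Fin 2) ℂ))
    {B_H C₂ R R₀ a₃ B_Δ C₃ h₁ B_CH : ℝ}
    (hH : ∀ (X : β' → Matrix (Fin 2) (Fin 2) ℂ) (t : ℝ), (∀ c', ‖X c'‖ ≤ t) →
      (∀ b, w 1 b * ‖H X b‖ ≤ B_H * t) ∧ ∀ (b : PBond (F.P K) 0) (ν : Fin 3), w 2 b * (F.L : ℝ) ^ (K - n) * ‖H X ⟨b.src.shift ν, b.dir⟩ - H X b‖ ≤ B_H * t)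
    (hD : ∀ (Y : PBond (F.P K) 0 → Matrix (Fin 2) (Fin 2) ℂ) (r' : ℝ), r' < R → (∀ b, w 1 b * ‖Y b‖ ≤ r') →
      (∀ (b : PBond (F.P K) 0) (ν : Fin 3), w 2 b * (F.L : ℝ) ^ (K - n) * ‖Y ⟨b.src.shift ν, b.dir⟩ - Y b‖ ≤ r') → ∀ c', ‖D Y c'‖ ≤ 4 * C₂ * r' ^ 2)
    (hX1 : ∀ (X : β' → Matrix (Fin 2) (Fin 2) ℂ) (t : ℝ), 0 ≤ t → (∀ c', ‖X c'‖ ≤ t) → ∀ b : PBond (F.P K) 0,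
      w 3 b * ‖(((((((F.L : ℝ)⁻¹) ^ (K - n)) : ℝ) : ℂ) ^ 2)⁻¹ • ∑ p : Plaq (F.P K) 0, ((Pi.single b (1 : ℂ) : PBond (F.P K) 0 → ℂ) ⟨p.src, p.μ⟩ + (Pi.single b (1 : ℂ) : PBond (F.P K) 0 → ℂ) ⟨p.src.shift p.μ, p.ν⟩ - (Pi.single b (1 : ℂ) : PBond (F.P K) 0 → ℂ) ⟨p.src.shift p.ν, p.μ⟩ - (Pi.single b (1 : ℂ) : PBond (F.P K) 0 → ℂ) ⟨p.src, p.ν⟩) • (H X ⟨p.src, p.μ⟩ + H X ⟨p.src.shift p.μ, p.ν⟩ - H X ⟨p.src.shift p.ν, p.μ⟩ - H X ⟨p.src, p.ν⟩))‖ ≤ B_Δ * t)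
    (h49 : ∀ (Y : PBond (F.P K) 0 → Matrix (Fin 2) (Fin 2) ℂ) (r : ℝ), r < R → (∀ b, w 1 b * ‖Y b‖ ≤ r) →
      (∀ (b : PBond (F.P K) 0) (ν : Fin 3), w 2 b * (F.L : ℝ) ^ (K - n) * ‖Y ⟨b.src.shift ν, b.dir⟩ - Y b‖ ≤ r) →
      ∀ᶠ X in 𝓝 Y, D X = C (X - H (D X)))
    (hDd : ∀ (Y : PBond (F.P K) 0 → Matrix (Fin 2) (Fin 2) ℂ) (r : ℝ), r < R → (∀ b, w 1 b * ‖Y b‖ ≤ r) →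
      (∀ (b : PBond (F.P K) 0) (ν : Fin 3), w 2 b * (F.L : ℝ) ^ (K - n) * ‖Y ⟨b.src.shift ν, b.dir⟩ - Y b‖ ≤ r) → DifferentiableAt ℂ D Y)
    (hCd : ∀ (Y : PBond (F.P K) 0 → Matrix (Fin 2) (Fin 2) ℂ) (r : ℝ), r < R → (∀ b, w 1 b * ‖Y b‖ ≤ r) →
      (∀ (b : PBond (F.P K) 0) (ν : Fin 3), w 2 b * (F.L : ℝ) ^ (K - n) * ‖Y ⟨b.src.shift ν, b.dir⟩ - Y b‖ ≤ r) → DifferentiableAt ℂ C (Y - H (D Y)))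
    (hCcol : ∀ (Y : PBond (F.P K) 0 → Matrix (Fin 2) (Fin 2) ℂ) (r : ℝ), r < R → (∀ b, w 1 b * ‖Y b‖ ≤ r) →
      (∀ (b : PBond (F.P K) 0) (ν : Fin 3), w 2 b * (F.L : ℝ) ^ (K - n) * ‖Y ⟨b.src.shift ν, b.dir⟩ - Y b‖ ≤ r) →
      ∀ δ : PBond (F.P K) 0 → Matrix (Fin 2) (Fin 2) ℂ, ∑ c', u c' * ‖fderiv ℂ C (Y - H (D Y)) δ c'‖ ≤ C₃ * r * ∑ b, (w 3 b)⁻¹ * ‖δ b‖)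
    (hHcol : ∀ X : β' → Matrix (Fin 2) (Fin 2) ℂ, ∑ b, (w 3 b)⁻¹ * ‖H X b‖ ≤ h₁ * ∑ c', u c' * ‖X c'‖)
    (hCH : ∀ (Z : PBond (F.P K) 0 → Matrix (Fin 2) (Fin 2) ℂ) (s : ℝ), 0 ≤ s → (∀ b, w 1 b * ‖Z b‖ ≤ s) →
      (∀ (b : PBond (F.P K) 0) (ν : Fin 3), w 2 b * (F.L : ℝ) ^ (K - n) * ‖Z ⟨b.src.shift ν, b.dir⟩ - Z b‖ ≤ s) →
      ∀ X : β' → Matrix (Fin 2) (Fin 2) ℂ, ‖∑ b, Matrix.trace ((((((((F.L : ℝ)⁻¹) ^ (K - n)) : ℝ) : ℂ) ^ 2)⁻¹ • ∑ p : Plaq (F.P K) 0, ((Pi.single b (1 : ℂ) : PBond (F.P K) 0 → ℂ) ⟨p.src, p.μ⟩ + (Pi.single b (1 : ℂ) : PBond (F.P K) 0 → ℂ) ⟨p.src.shift p.μ, p.ν⟩ - (Pi.single b (1 : ℂ) : PBond (F.P K) 0 → ℂ) ⟨p.src.shift p.ν, p.μ⟩ - (Pi.single b (1 : ℂ) : PBond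 (F.P K) 0 → ℂ) ⟨p.src, p.ν⟩) • (H X ⟨p.src, p.μ⟩ + H X ⟨p.src.shift p.μ, p.ν⟩ - H X ⟨p.src.shift p.ν, p.μ⟩ - H X ⟨p.src, p.ν⟩)) * Z b)‖ ≤ B_CH * s * ∑ c', u c' * ‖X c'‖)
    (hsmall : C₃ * R * h₁ ≤ 1 / 2) (hC₃ : 0 ≤ C₃) (hh₁ : 0 ≤ h₁) (hB_CH : 0 ≤ B_CH)
    (hC₂ : 0 ≤ C₂) (hB_H : 0 ≤ B_H) (hR₀0 : 0 ≤ R₀) (hR₀ : R₀ < R) (ha₃ : a₃ ≤ R₀)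
    (hθ : (1 + 4 * B_H * C₂ * R₀) * a₃ ≤ 1 / (2 * (F.L : ℝ))) :
    ∃ W₀ : (PBond (F.P K) 0 → Matrix (Fin 2) (Fin 2) ℂ) → (PBond (F.P K) 0 → Matrix (Fin 2) (Fin 2) ℂ),
      (∀ A δ : PBond (F.P K) 0 → Matrix (Fin 2) (Fin 2) ℂ, fderiv ℂ (fun A : PBond (F.P K) 0 → Matrix (Fin 2) (Fin 2) ℂ => (∑ p : Plaq (F.P K) 0, (1 - (2 : ℂ)⁻¹ * Matrix.trace (exp ((Complex.I * (((((F.L : ℝ)⁻¹) ^ (K - n) : ℝ)) : ℂ)) • A ⟨p.src, p.μ⟩) * exp ((Complex.I * (((((F.L : ℝ)⁻¹) ^ (K - n) : ℝ)) : ℂ)) • A ⟨p.src.shift p.μ, p.ν⟩) * exp (-((Complex.I * (((((F.L : ℝ)⁻¹) ^ (K - n) : ℝ)) : ℂ)) • A ⟨p.src.shift p.ν, p.μ⟩)) * exp (-((Complex.I * (((((F.L : ℝ)⁻¹) ^ (K - n) : ℝ)) : ℂ)) • A ⟨p.src, p.ν⟩))) + (2 : ℂ)⁻¹ * Matrix.trace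 (((Complex.I * (((((F.L : ℝ)⁻¹) ^ (K - n) : ℝ)) : ℂ)) • A ⟨p.src, p.μ⟩) + ((Complex.I * (((((F.L : ℝ)⁻¹) ^ (K - n) : ℝ)) : ℂ)) • A ⟨p.src.shift p.μ, p.ν⟩) + (-((Complex.I * (((((F.L : ℝ)⁻¹) ^ (K - n) : ℝ)) : ℂ)) • A ⟨p.src.shift p.ν, p.μ⟩)) + (-((Complex.I * (((((F.L : ℝ)⁻¹) ^ (K - n) : ℝ)) : ℂ)) • A ⟨p.src, p.ν⟩))) + (4 : ℂ)⁻¹ * Matrix.trace ((((Complex.I * (((((F.L : ℝ)⁻¹) ^ (K - n) : ℝ)) : ℂ)) • A ⟨p.src, p.μ⟩) + ((Complex.I * (((((F.L : ℝ)⁻¹) ^ (K - n) : ℝ)) : ℂ)) • A ⟨p.src.shift p.μ, p.ν⟩) + (-((Complex.I * (((((F.L : ℝ)⁻¹) ^ (K - n) : ℝ)) : ℂ)) • A ⟨p.src.shift p.ν, p.μ⟩)) + (-((Complex.I * (((((F.L : ℝ)⁻¹) ^ (K - n) : ℝ)) : ℂ)) • A ⟨p.src, p.ν⟩))) ^ 2))))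 A δ =
        ((((F.L : ℝ)⁻¹) ^ (K - n) : ℝ) : ℂ) ^ 4 * ∑ b : PBond (F.P K) 0, Matrix.trace (W₀ A b * δ b)) ∧
      Differentiable ℂ W₀ ∧
      ∀ E : (PBond (F.P K) 0 → Matrix (Fin 2) (Fin 2) ℂ) → (PBond (F.P K) 0 → Matrix (Fin 2) (Fin 2) ℂ),
        (∀ (Y : PBond (F.P K) 0 → Matrix (Fin 2) (Fin 2) ℂ) (b : PBond (F.P K) 0) (i j : Fin 2), E Y b i j = ((((((F.L : ℝ)⁻¹) ^ (K - n)) : ℝ) : ℂ) ^ 4)⁻¹ *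
          (-(((((((F.L : ℝ)⁻¹) ^ (K - n)) : ℝ) : ℂ) ^ 2 / 2) * ∑ p : Plaq (F.P K) 0, Matrix.trace ((H (D Y) ⟨p.src, p.μ⟩ + H (D Y) ⟨p.src.shift p.μ, p.ν⟩ - H (D Y) ⟨p.src.shift p.ν, p.μ⟩ - H (D Y) ⟨p.src, p.ν⟩) *
              (((Pi.single b (Matrix.single j i (1 : ℂ)) : PBond (F.P K) 0 → Matrix (Fin 2) (Fin 2) ℂ)) ⟨p.src, p.μ⟩ + ((Pi.single b (Matrix.single j i (1 : ℂ)) : PBond (F.P K) 0 → Matrix (Fin 2) (Fin 2) ℂ)) ⟨p.src.shift p.μ, p.ν⟩ -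
                ((Pi.single b (Matrix.single j i (1 : ℂ)) : PBond (F.P K) 0 → Matrix (Fin 2) (Fin 2) ℂ)) ⟨p.src.shift p.ν, p.μ⟩ - ((Pi.single b (Matrix.single j i (1 : ℂ)) : PBond (F.P K) 0 → Matrix (Fin 2) (Fin 2) ℂ)) ⟨p.src, p.ν⟩)))
            - ((((((F.L : ℝ)⁻¹) ^ (K - n)) : ℝ) : ℂ) ^ 2 / 2) * ∑ p : Plaq (F.P K) 0, Matrix.trace (((Y - H (D Y)) ⟨p.src, p.μ⟩ + (Y - H (D Y)) ⟨p.src.shift p.μ, p.ν⟩ - (Y - H (D Y)) ⟨p.src.shift p.ν, p.μ⟩ - (Y - H (D Y)) ⟨p.src, p.ν⟩) *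
              (H (fderiv ℂ D Y (Pi.single b (Matrix.single j i (1 : ℂ)))) ⟨p.src, p.μ⟩ + H (fderiv ℂ D Y (Pi.single b (Matrix.single j i (1 : ℂ)))) ⟨p.src.shift p.μ, p.ν⟩ -
                H (fderiv ℂ D Y (Pi.single b (Matrix.single j i (1 : ℂ)))) ⟨p.src.shift p.ν, p.μ⟩ - H (fderiv ℂ D Y (Pi.single b (Matrix.single j i (1 : ℂ)))) ⟨p.src, p.ν⟩))
            - (((((F.L : ℝ)⁻¹) ^ (K - n)) : ℝ) : ℂ) ^ 4 * ∑ b' : PBond (F.P K) 0, Matrix.trace (W₀ (Y - H (D Y)) b' * H (fderiv ℂ D Y (Pi.single b (Matrix.single j i (1 : ℂ)))) b'))) →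
        ∀ (Y : PBond (F.P K) 0 → Matrix (Fin 2) (Fin 2) ℂ) (r : ℝ), r < a₃ → (∀ b, w 1 b * ‖Y b‖ ≤ r) →
          (∀ (b : PBond (F.P K) 0) (ν : Fin 3), w 2 b * (F.L : ℝ) ^ (K - n) * ‖Y ⟨b.src.shift ν, b.dir⟩ - Y b‖ ≤ r) →
          ∀ b, w 3 b * ‖(W₀ (Y - H (D Y)) + E Y) b‖ ≤
            (12 * ((F.L : ℝ) ^ 3 * (1428 + (F.L : ℝ))) * (1 + 4 * B_H * C₂ * R₀) ^ 2 +
              (2 * B_Δ * C₂ + 2⁻¹ * (8 * C₃ * B_CH) * (1 + 4 * B_H * C₂ * R₀) +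
                (16 * h₁ * C₃) * R₀ * (12 * ((F.L : ℝ) ^ 3 * (1428 + (F.L : ℝ)))) * (1 + 4 * B_H * C₂ * R₀) ^ 2)) * r ^ 2 := by
  obtain ⟨W₀, hgrad, hW₀d, -, hW₀q⟩ := exists_gradient_weighted98_cubeSeq_T3 F n K x₀ ρ S M hM hS hw
  refine ⟨W₀, hgrad, hW₀d, fun E hE => ?_⟩
  have hL0 : (0 : ℝ) < F.L := by exact_mod_cast F.hL.2.le.trans_lt' zero_lt_one
  have hη : (((F.L : ℝ)⁻¹) ^ (K - n)) ≠ 0 := pow_ne_zero _ (inv_ne_zero hL0.ne')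
  have hwnn : ∀ m b, 0 ≤ w m b := fun m b => by rw [hw m b]; positivity
  have hw3 : ∀ b, 0 < w 3 b := fun b => by rw [hw 3 b]; positivity
  have hc : (0 : ℝ) ≤ (F.L : ℝ) ^ (K - n) := by positivity
  exact hWq_dressed_of_columnLetters (((F.L : ℝ)⁻¹) ^ (K - n)) hη w hwnn hw3 ((F.L : ℝ) ^ (K - n)) hc u hu (fun Y => W₀ (Y - H (D Y)) + E Y) W₀ E H C D
    (fun Y => rfl) hE hW₀q hH hD hX1 h49 hDd hCd hCcol hHcol hCH hsmall hC₃ hh₁ hB_CH hC₂ hB_H hR₀0 hR₀ ha₃ hθ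

end T3

end Summit.QuantumFields.YangMills.Theorems.HalvingDressingLetter

end
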